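import Summits.Ventures.PercRepro.ProfileGapMonoThresholdGenericPred
import Summits.Ventures.PercRepro.ProfileGapMonoThresholdSucc

/-!
# PercRepro — THE THRESHOLD FAMILY FROM THE RULE ON THE SMALLER HARD CLASS «NO `(q−1)`-GENERIC POINT» (p5, gen 25;
`proofs/P5-GM1.md` §25; announced INBOX before typing)

With `delMonoT_of_genericQ_pred` (`ProfileGapMonoThresholdGenericPred`) the generic case of the inner induction
dispatches every `(q−1)`-generic non-loop point, so the assembly of `ProfileGapMonoThresholdComplement`
(`thresholdIneq_of_hardRuleT'`: every offset `≥ 0` from the rule on the hard class alone) and of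
`ProfileGapMonoThresholdSucc` (the band case `t = q + 1` from the single rule instance) go through with the rule
restricted to the SMALLER hard class `HardTPred N q` — no loop, no parallel pair, no coloop, no `(q−1)`-generic
point (every point in a cocircuit `D` with `ρ(D ∖ z) ≤ q − 1`).  `HardTPred N q → HardT N q` (a `q`-generic point
is `(q−1)`-generic), so `HardRuleT α q t → HardRuleTPred α q t`: the new rule is WEAKER than the old one and
gives the same conclusions.  At co-rank `3`: `(I_4)`, `(★_3)` at `u = 4` and `(GM)_3` at every coloop at `u = 4`
from `HardRuleTPred α 3 4` — the rule on the simple coloop-free matroids in which every point lies in a series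
pair or in a cocircuit whose other elements lie on a line.

* `HardTPred` (class), `HardRuleTPred` (conjecture def, NOT asserted), `hardT_of_hardTPred`,
  `hardRuleTPred_of_hardRuleT`, `thresholdIneq_of_hardRuleTPred_aux`, **`thresholdIneq_of_hardRuleTPred`**,
  `thresholdIneq_row_of_hardRuleTPred`, **`profileIneqMinusQ_pred_of_hardRuleTPred`**,
  `thresholdIneq_succ_of_hardRuleTPred_aux`, **`thresholdIneq_succ_of_hardRuleTPred`**,
  **`thresholdIneq_three_four_of_hardRuleTPred`**, `starQ_three_four_of_rulePred`,
  **`gapMonoQ_coloop_three_four_of_rulePred`**.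
-/

open scoped Matroid

namespace PercRepro.Cogirth

open Finset ThmH Skew Shadow Profile

variable {α : Type} [DecidableEq α] {M : Matroid α} [M.Finite]

section HardPred

/-- **The smaller hard class at co-rank `q`**: no loop, no parallel pair, no coloop, no `(q−1)`-generic point. -/
def HardTPred (N : Matroid α) [N.Finite] (q : ℕ) : Prop :=
  (∀ x ∈ gr N, rk N {x} = 1) ∧
  (∀ x ∈ gr N, ∀ y ∈ gr N, x ≠ y → rk N {x, y} ≠ 1) ∧
  (∀ x ∈ gr N, rk N ((gr N).erase x) + 1 ≠ rk N (gr N)) ∧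
  (∀ x ∈ gr N, ¬ GenericQ N x (q - 1))

/-- **The rule on the smaller hard class** (a CONJECTURE, NOT asserted): every matroid of the smaller hard class on
a nonempty ground set has a deletion-monotone point for `(q, t)`. -/
def HardRuleTPred (α : Type) [DecidableEq α] (q t : ℕ) : Prop :=
  ∀ (N : Matroid α) [N.Finite], HardTPred N q → (gr N).Nonempty → ∃ z ∈ gr N, DelMonoT N z q t

/-- A `q`-generic point is `(q−1)`-generic. -/
theorem genericQ_pred_of_genericQ {N : Matroid α} [N.Finite] {z : α} {q : ℕ} (hg : GenericQ N z q) :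
    GenericQ N z (q - 1) :=
  fun X hX hrk => hg X hX (by omega)

/-- The smaller hard class lies in the hard class. -/
theorem hardT_of_hardTPred {N : Matroid α} [N.Finite] {q : ℕ} (h : HardTPred N q) : HardT N q :=
  ⟨h.1, h.2.1, h.2.2.1, fun x hx hg => h.2.2.2 x hx (genericQ_pred_of_genericQ hg)⟩

/-- The rule on the hard class gives the rule on the smaller hard class. -/
theorem hardRuleTPred_of_hardRuleT {q t : ℕ} (h : HardRuleT α q t) : HardRuleTPred α q t :=
  fun N _ hN hne => h N (hardT_of_hardTPred hN) hne

/-- The inner induction on `#E` at a fixed co-rank `q ≥ 2`, every `t ≥ q` at once, WITHOUT a row hypothesis, given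
the family one co-rank down and the rule on the smaller hard class: the generic case dispatches every
`(q−1)`-generic point by `delMonoT_of_genericQ_pred`. -/
theorem thresholdIneq_of_hardRuleTPred_aux {q : ℕ} (hq : 2 ≤ q)
    (hprev : ∀ (K : Matroid α) [K.Finite] (t' : ℕ), q - 1 ≤ t' → ThresholdIneq K (q - 1) t')
    (hrule : ∀ t', q ≤ t' → HardRuleTPred α q t') (n : ℕ) :
    ∀ (N : Matroid α) [N.Finite], (gr N).card = n → ∀ t, q ≤ t → ThresholdIneq N q t := by
  induction n using Nat.strong_induction_on with
  | _ n ih =>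
  intro N _ hN t hqt
  have ihdel : ∀ z ∈ gr N, ∀ t', q ≤ t' → ThresholdIneq (N ＼ ({z} : Set α)) q t' := by
    intro z hz t' ht'
    have hlt : ((gr N).erase z).card < n := by rw [← hN]; exact card_erase_lt_of_mem hz
    exact ih _ hlt (N ＼ ({z} : Set α)) (by rw [gr_delete']) t' ht'
  have ihdel' : ∀ z ∈ gr N, ∀ t', q - 1 ≤ t' → ThresholdIneq (N ＼ ({z} : Set α)) q t' := by
    intro z hz t' ht'
    rcases Nat.lt_or_ge t' q with h | h
    · have : t' = q - 1 := by omega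
      rw [this]
      exact (thresholdIneq_pred_iff (by omega)).2 (ihdel z hz q (le_refl q))
    · exact ihdel z hz t' h
  rcases (gr N).eq_empty_or_nonempty with hempty | hne
  · exact thresholdIneq_of_card_eq_zero (by rw [hempty, card_empty])
  -- a loop
  by_cases hloop : ∃ ℓ ∈ gr N, rk N {ℓ} = 0
  · obtain ⟨ℓ, hℓ, h0⟩ := hloop
    exact thresholdIneq_of_loop hℓ h0 (ihdel ℓ hℓ t hqt)
  -- a parallel pair
  by_cases hpar : ∃ z ∈ gr N, ∃ z' ∈ gr N, z ≠ z' ∧ rk N {z, z'} = 1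
  · obtain ⟨z, hz, z', hz', hzz', hpar⟩ := hpar
    have hz1 : rk N {z} = 1 := by
      have h1 := rk_mono' (M := N) (show ({z} : Finset α) ⊆ {z, z'} by simp)
      have h2 : rk N {z} ≠ 0 := fun h => hloop ⟨z, hz, h⟩
      omega
    have hz'1 : rk N {z'} = 1 := by
      have h1 := rk_mono' (M := N) (show ({z'} : Finset α) ⊆ {z, z'} by simp)
      have h2 : rk N {z'} ≠ 0 := fun h => hloop ⟨z', hz', h⟩
      omega
    have hdm := delMonoT_of_parallel hz hz' hzz' hz1 hz'1 hpar hq (by omega)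
      (hprev _ (t - 1) (by omega))
    exact thresholdIneq_of_delMonoT hdm (ihdel z hz t hqt)
  -- a coloop
  by_cases hcol : ∃ z ∈ gr N, rk N ((gr N).erase z) + 1 = rk N (gr N)
  · obtain ⟨z, hz, hzc⟩ := hcol
    exact thresholdIneq_of_coloop hz hzc hq (by omega) (ihdel' z hz (t - 1) (by omega))
      (hprev _ t (by omega))
  -- a `(q−1)`-generic point
  by_cases hgen : ∃ z ∈ gr N, GenericQ N z (q - 1)
  · obtain ⟨z, hz, hg⟩ := hgen
    have hz1 : rk N {z} = 1 := by
      have h2 : rk N {z} ≠ 0 := fun h => hloop ⟨z, hz, h⟩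
      have h3 : rk N {z} ≤ 1 := by
        have := rk_le_card (M := N) ({z} : Finset α)
        simpa using this
      omega
    have hzI : N.Indep {z} := by
      have h := indep_of_rk_eq_card (M := N) (X := {z}) (by rw [card_singleton]; exact hz1)
      rwa [coe_singleton] at h
    have hdm := delMonoT_of_genericQ_pred hzI hg hq (by omega) (hprev _ (t - 1) (by omega))
    exact thresholdIneq_of_delMonoT hdm (ihdel z hz t hqt)
  -- the smaller hard class: the rule
  have hhard : HardTPred N q := by
    refine ⟨?_, ?_, ?_, ?_⟩
    · intro x hx
      have h2 : rk N {x} ≠ 0 := fun h => hloop ⟨x, hx, h⟩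
      have h3 : rk N {x} ≤ 1 := by
        have := rk_le_card (M := N) ({x} : Finset α)
        simpa using this
      omega
    · intro x hx y hy hxy h
      exact hpar ⟨x, hx, y, hy, hxy, h⟩
    · intro x hx h
      exact hcol ⟨x, hx, h⟩
    · intro x hx h
      exact hgen ⟨x, hx, h⟩
  obtain ⟨z, hz, hdm⟩ := hrule t hqt N hhard hne
  exact thresholdIneq_of_delMonoT hdm (ihdel z hz t hqt)

/-- **The threshold family at every offset `≥ 0` from the rule on the smaller hard class ALONE**: for `2 ≤ q ≤ t`,
`(I_t)` on every finite matroid, given `HardRuleTPred α q' t'` for all `2 ≤ q' ≤ q`, `q' ≤ t'`. -/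
theorem thresholdIneq_of_hardRuleTPred (hrule : ∀ q' t', 2 ≤ q' → q' ≤ t' → HardRuleTPred α q' t') :
    ∀ q, 2 ≤ q → ∀ (N : Matroid α) [N.Finite], ∀ t, q ≤ t → ThresholdIneq N q t := by
  intro q
  induction q with
  | zero => intro h; omega
  | succ q ihq =>
    intro hq N _ t hqt
    have hprev : ∀ (K : Matroid α) [K.Finite] (t' : ℕ), q + 1 - 1 ≤ t' → ThresholdIneq K (q + 1 - 1) t' := by
      intro K _ t' ht'
      rw [Nat.add_sub_cancel] at ht' ⊢
      rcases Nat.lt_or_ge q 2 with h | h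
      · have : q = 1 := by omega
        rw [this]; exact thresholdIneq_one K t'
      · exact ihq h K t' ht'
    exact thresholdIneq_of_hardRuleTPred_aux hq hprev (fun t' ht' => hrule (q + 1) t' hq ht') _ N rfl t hqt

/-- **The rows `(q−1, q)` of every co-rank `q ≥ 2` from the rule on the smaller hard class alone** (threshold
form). -/
theorem thresholdIneq_row_of_hardRuleTPred (hrule : ∀ q' t', 2 ≤ q' → q' ≤ t' → HardRuleTPred α q' t')
    {q : ℕ} (hq : 2 ≤ q) (N : Matroid α) [N.Finite] : ThresholdIneq N q (q - 1) :=
  (thresholdIneq_pred_iff (by omega)).2 (thresholdIneq_of_hardRuleTPred hrule q hq N q (le_refl q))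

/-- **The rows `(q−1, q)` of the profile, every co-rank `q ≥ 2`, from the rule on the smaller hard class alone.** -/
theorem profileIneqMinusQ_pred_of_hardRuleTPred (hrule : ∀ q' t', 2 ≤ q' → q' ≤ t' → HardRuleTPred α q' t')
    {q : ℕ} (hq : 2 ≤ q) (N : Matroid α) [N.Finite] : ProfileIneqMinusQ N (q - 1) q :=
  (thresholdIneq_iff_row (by omega)).1 (thresholdIneq_row_of_hardRuleTPred hrule hq N)

/-- The inner induction on `#E` for the single threshold `t = q + 1` (`2 ≤ q`) on the smaller hard class: the family
one co-rank down, the row `(q−1, q)` in its offset-`0` form, and the rule `HardRuleTPred α q (q+1)` only. -/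
theorem thresholdIneq_succ_of_hardRuleTPred_aux {q : ℕ} (hq : 2 ≤ q)
    (hprev : ∀ (K : Matroid α) [K.Finite] (t' : ℕ), q - 1 ≤ t' → ThresholdIneq K (q - 1) t')
    (hrow : ∀ (K : Matroid α) [K.Finite], ThresholdIneq K q q)
    (hrule : HardRuleTPred α q (q + 1)) (n : ℕ) :
    ∀ (N : Matroid α) [N.Finite], (gr N).card = n → ThresholdIneq N q (q + 1) := by
  induction n using Nat.strong_induction_on with
  | _ n ih =>
  intro N _ hN
  have ihdel : ∀ z ∈ gr N, ThresholdIneq (N ＼ ({z} : Set α)) q (q + 1) := by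
    intro z hz
    have hlt : ((gr N).erase z).card < n := by rw [← hN]; exact card_erase_lt_of_mem hz
    exact ih _ hlt (N ＼ ({z} : Set α)) (by rw [gr_delete'])
  rcases (gr N).eq_empty_or_nonempty with hempty | hne
  · exact thresholdIneq_of_card_eq_zero (by rw [hempty, card_empty])
  -- a loop
  by_cases hloop : ∃ ℓ ∈ gr N, rk N {ℓ} = 0
  · obtain ⟨ℓ, hℓ, h0⟩ := hloop
    exact thresholdIneq_of_loop hℓ h0 (ihdel ℓ hℓ)
  -- a parallel pair
  by_cases hpar : ∃ z ∈ gr N, ∃ z' ∈ gr N, z ≠ z' ∧ rk N {z, z'} = 1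
  · obtain ⟨z, hz, z', hz', hzz', hpar⟩ := hpar
    have hz1 : rk N {z} = 1 := by
      have h1 := rk_mono' (M := N) (show ({z} : Finset α) ⊆ {z, z'} by simp)
      have h2 : rk N {z} ≠ 0 := fun h => hloop ⟨z, hz, h⟩
      omega
    have hz'1 : rk N {z'} = 1 := by
      have h1 := rk_mono' (M := N) (show ({z'} : Finset α) ⊆ {z, z'} by simp)
      have h2 : rk N {z'} ≠ 0 := fun h => hloop ⟨z', hz', h⟩
      omega
    have hdm := delMonoT_of_parallel hz hz' hzz' hz1 hz'1 hpar hq (by omega)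
      (hprev _ (q + 1 - 1) (by omega))
    exact thresholdIneq_of_delMonoT hdm (ihdel z hz)
  -- a coloop
  by_cases hcol : ∃ z ∈ gr N, rk N ((gr N).erase z) + 1 = rk N (gr N)
  · obtain ⟨z, hz, hzc⟩ := hcol
    have h1 : ThresholdIneq (N ＼ ({z} : Set α)) q (q + 1 - 1) := by
      rw [Nat.add_sub_cancel]
      exact hrow _
    exact thresholdIneq_of_coloop hz hzc hq (by omega) h1 (hprev _ (q + 1) (by omega))
  -- a `(q−1)`-generic point
  by_cases hgen : ∃ z ∈ gr N, GenericQ N z (q - 1)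
  · obtain ⟨z, hz, hg⟩ := hgen
    have hz1 : rk N {z} = 1 := by
      have h2 : rk N {z} ≠ 0 := fun h => hloop ⟨z, hz, h⟩
      have h3 : rk N {z} ≤ 1 := by
        have := rk_le_card (M := N) ({z} : Finset α)
        simpa using this
      omega
    have hzI : N.Indep {z} := by
      have h := indep_of_rk_eq_card (M := N) (X := {z}) (by rw [card_singleton]; exact hz1)
      rwa [coe_singleton] at h
    have hdm := delMonoT_of_genericQ_pred hzI hg hq (by omega) (hprev _ (q + 1 - 1) (by omega))
    exact thresholdIneq_of_delMonoT hdm (ihdel z hz)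
  -- the smaller hard class: the rule
  have hhard : HardTPred N q := by
    refine ⟨?_, ?_, ?_, ?_⟩
    · intro x hx
      have h2 : rk N {x} ≠ 0 := fun h => hloop ⟨x, hx, h⟩
      have h3 : rk N {x} ≤ 1 := by
        have := rk_le_card (M := N) ({x} : Finset α)
        simpa using this
      omega
    · intro x hx y hy hxy h
      exact hpar ⟨x, hx, y, hy, hxy, h⟩
    · intro x hx h
      exact hcol ⟨x, hx, h⟩
    · intro x hx h
      exact hgen ⟨x, hx, h⟩
  obtain ⟨z, hz, hdm⟩ := hrule N hhard hne
  exact thresholdIneq_of_delMonoT hdm (ihdel z hz)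

/-- **The band case `(I_{q+1})` from the single rule instance `(q, q+1)` on the smaller hard class** (`2 ≤ q`),
given the family one co-rank down and the row `(q−1, q)` in its offset-`0` form. -/
theorem thresholdIneq_succ_of_hardRuleTPred {q : ℕ} (hq : 2 ≤ q)
    (hprev : ∀ (K : Matroid α) [K.Finite] (t' : ℕ), q - 1 ≤ t' → ThresholdIneq K (q - 1) t')
    (hrow : ∀ (K : Matroid α) [K.Finite], ThresholdIneq K q q)
    (hrule : HardRuleTPred α q (q + 1)) (N : Matroid α) [N.Finite] : ThresholdIneq N q (q + 1) :=
  thresholdIneq_succ_of_hardRuleTPred_aux hq hprev hrow hrule _ N rfl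

/-- **`(I_4)` at co-rank `3` from the single rule instance `HardRuleTPred α 3 4`** — the rule on the simple
coloop-free matroids in which every point lies in a cocircuit `D` with `ρ(D ∖ z) ≤ 2` (co-rank `2` and the row
`(2, 3)` are theorems). -/
theorem thresholdIneq_three_four_of_hardRuleTPred (hrule : HardRuleTPred α 3 4) (N : Matroid α) [N.Finite] :
    ThresholdIneq N 3 4 :=
  thresholdIneq_succ_of_hardRuleTPred (q := 3) (by norm_num)
    (fun K _ t' ht' => thresholdIneq_two K (by omega)) (fun K _ => thresholdIneq_three_three K) hrule N

/-- **`(★_3)` at `u = 4` from the single rule instance `HardRuleTPred α 3 4`.** -/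
theorem starQ_three_four_of_rulePred {z : α} (hrule : HardRuleTPred α 3 4) : StarQ M z 3 4 :=
  (starQ_succ_iff_thresholdIneq (by norm_num)).2 (thresholdIneq_three_four_of_hardRuleTPred hrule _)

/-- **`(GM)_3` at every coloop at the level `u = 4` from the single rule instance `HardRuleTPred α 3 4`** — the
first hard instance of the coloop band case, now from the rule on the smaller hard class. -/
theorem gapMonoQ_coloop_three_four_of_rulePred {z : α} (hz : z ∈ gr M)
    (hzc : rk M ((gr M).erase z) + 1 = rk M (gr M)) (hrule : HardRuleTPred α 3 4) : GapMonoQ M z 3 4 := by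
  have hrow : ProfileIneqMinusQ (M ＼ ({z} : Set α)) 3 (3 + 1 - 1) := by
    rw [Nat.add_sub_cancel]
    exact profileIneqMinusQ_self _ 3
  exact gapMonoQ_of_coloop_of_starQ hz hzc (by norm_num) (by norm_num) hrow (starQ_three_four_of_rulePred hrule)

end HardPred

end PercRepro.Cogirth
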